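import Literature.Geometry.Symplectic.SteinLiouvilleField
import Mathlib.Analysis.SpecialFunctions.Sqrt
import Mathlib.Analysis.Complex.Circle
import HarnessLib

/-!
# The rotation by a right angle in a plane, generated by a `2`-form

Topic `Literature/Geometry/Symplectic`; linear-algebra infrastructure for the symplectic
tubular neighbourhood of a symplectic surface (McLean, *The growth rate of symplectic homology
and affine varieties*, GAFA 2012, Lemma 5.14 with `k = 1`: "the structure group
`U(1) × ⋯ × U(1)`", i.e. the fibrewise rotations of the normal `2`-planes; fact seat of
`Literature.Geometry.Symplectic.mclean_divisorComplement_convex_four`).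

Let `V` be a finite-dimensional real inner product space, `W ⊆ V` a `2`-plane with orthogonal
projection `Q`, and `o` a `2`-form on `V` which does not vanish on `W`. We construct, by explicit
formulas in `(Q, o)` — so that everything depends smoothly on these data — the operator
`Ω = Q A_o Q` (`planeOp`; `⟪Ω v, w⟫ = o(Q v, Q w)`, `A_o = formOp o` the skew operator
representing `o`), the positive number `a` with `Ω² = -a² Q` (`planeRotSq = a²`, half the
Hilbert–Schmidt norm of `Ω`), and **the rotation by a right angle** `J = a⁻¹ Ω` (`planeRot`):

* `planeRot_comp_planeRot` — `J² = -Q`; `starProjection_comp_planeRot`,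
  `planeRot_comp_starProjection` — `Q J = J Q = J`; `inner_planeRot_left` — `J` is skew;
  `inner_planeRot_planeRot` — `J` is an isometry of `W`; `twoForm_planeRot_pos` —
  **`o(v, J v) > 0` for `0 ≠ v ∈ W`**: `J` is the rotation by `+π/2` for the orientation of `W`
  defined by `o` (this is McDuff–Salamon's `J = (-A²)^{-1/2} A`, Prop. 2.5.6, in the plane `W`,
  where `(-A²)^{1/2} = a Q`);
* `contDiffAt_planeRot` — `(Q, o) ↦ J` is `C^∞` wherever `a² > 0`.

Everything here is proved; no named facts (D-0026).

## References

* D. McDuff, D. Salamon, *Introduction to Symplectic Topology*, 3rd ed. (2017), Prop. 2.5.6,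
  eqs. (2.5.12)–(2.5.14). [McDuffSalamon2017]
* M. McLean, *The growth rate of symplectic homology and affine varieties*, GAFA 22 (2012),
  Lemma 5.14. [Mclean2012]
-/

noncomputable section

open scoped RealInnerProductSpace ContDiff Topology
open Module Finset Function

namespace Literature.Geometry.Symplectic

variable {V : Type*} [NormedAddCommGroup V] [InnerProductSpace ℝ V] [FiniteDimensional ℝ V]

/-! ### Two-forms: elementary algebra -/

omit [FiniteDimensional ℝ V] in
/-- Antisymmetry of a `2`-form (a private copy of `Literature.Geometry.Kaehler.cam₂_swap`, kept
here to avoid the Kähler import closure). [folklore] -/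
private theorem twoForm_swap' (o : V [⋀^Fin 2]→L[ℝ] ℝ) (v w : V) : o ![v, w] = -o ![w, v] := by
  rw [← alt2Flat_apply, ← alt2Flat_apply]
  have h := o.map_swap ![w, v] (show (0 : Fin 2) ≠ 1 by decide)
  have hs : (![w, v] ∘ Equiv.swap (0 : Fin 2) 1) = ![v, w] := by
    funext i; fin_cases i <;> rfl
  rw [hs] at h
  rw [alt2Flat_apply, alt2Flat_apply]
  exact h

omit [FiniteDimensional ℝ V] in
/-- A `2`-form vanishes on the diagonal. [folklore] -/
theorem twoForm_self (o : V [⋀^Fin 2]→L[ℝ] ℝ) (v : V) : o ![v, v] = 0 := by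
  have h := twoForm_swap' o v v
  linarith

/-! ### The skew operator representing a `2`-form -/

/-- **The skew operator `A_o` representing the `2`-form `o`**: `⟪A_o v, w⟫ = o(v, w)`, written on
the standard orthonormal basis `e` of `V` as `A_o v = Σᵢ o(v, eᵢ) eᵢ` (McDuff–Salamon (2.5.12)),
as a continuous linear map. [cite: McDuffSalamon2017, Prop. 2.5.6 (2.5.12)] -/
def formOp (o : V [⋀^Fin 2]→L[ℝ] ℝ) : V →L[ℝ] V :=
  ∑ i, ((ContinuousLinearMap.apply ℝ ℝ (stdOrthonormalBasis ℝ V i)).comp (alt2Flat o)).smulRight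
    (stdOrthonormalBasis ℝ V i)

/-- Unfolding of `formOp`. [folklore] -/
theorem formOp_apply (o : V [⋀^Fin 2]→L[ℝ] ℝ) (v : V) :
    formOp o v = ∑ i, o ![v, stdOrthonormalBasis ℝ V i] • stdOrthonormalBasis ℝ V i := by
  rw [formOp, _root_.sum_apply]
  refine Finset.sum_congr rfl fun i _ ↦ ?_
  rw [ContinuousLinearMap.smulRight_apply, ← alt2Flat_apply]
  rfl

/-- **`⟪A_o v, w⟫ = o(v, w)`** (McDuff–Salamon (2.5.12)). [cite: McDuffSalamon2017, Prop. 2.5.6 (2.5.12)] -/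
theorem inner_formOp_left (o : V [⋀^Fin 2]→L[ℝ] ℝ) (v w : V) : ⟪formOp o v, w⟫ = o ![v, w] := by
  rw [formOp_apply, sum_inner]
  simp_rw [inner_smul_left, RCLike.conj_to_real]
  conv_rhs => rw [← (stdOrthonormalBasis ℝ V).sum_repr' w, ← alt2Flat_apply, map_sum]
  simp_rw [map_smul, smul_eq_mul, alt2Flat_apply]
  exact Finset.sum_congr rfl fun i _ ↦ mul_comm _ _

/-- `⟪v, A_o w⟫ = -o(v, w)`. [folklore] -/
theorem inner_formOp_right (o : V [⋀^Fin 2]→L[ℝ] ℝ) (v w : V) : ⟪v, formOp o w⟫ = -o ![v, w] := by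
  rw [real_inner_comm, inner_formOp_left, twoForm_swap']

/-- `o ↦ A_o` is `C^∞` (it is linear). [folklore] -/
theorem contDiff_formOp : ContDiff ℝ ∞ (formOp : (V [⋀^Fin 2]→L[ℝ] ℝ) → V →L[ℝ] V) := by
  have heq : (formOp : (V [⋀^Fin 2]→L[ℝ] ℝ) → V →L[ℝ] V) = fun o ↦
      ∑ i, ContinuousLinearMap.smulRightL ℝ V V
        ((ContinuousLinearMap.apply ℝ ℝ (stdOrthonormalBasis ℝ V i)).comp (alt2Flat o))
        (stdOrthonormalBasis ℝ V i) := by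
    funext o
    rfl
  rw [heq]
  refine ContDiff.sum fun i _ ↦ ?_
  have h1 : ContDiff ℝ ∞ fun o : V [⋀^Fin 2]→L[ℝ] ℝ ↦
      (ContinuousLinearMap.apply ℝ ℝ (stdOrthonormalBasis ℝ V i)).comp (alt2Flat o) :=
    contDiff_const.clm_comp contDiff_alt2Flat
  exact ((ContinuousLinearMap.smulRightL ℝ V V).contDiff.comp h1).clm_apply contDiff_const

/-! ### The operator of a `2`-form on a plane -/

/-- **The operator `Ω = Q A_o Q` of the `2`-form `o` compressed to the range of the projection
`Q`**: `⟪Ω v, w⟫ = o(Q v, Q w)` for a self-adjoint `Q`. [folklore] -/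
def planeOp (Q : V →L[ℝ] V) (o : V [⋀^Fin 2]→L[ℝ] ℝ) : V →L[ℝ] V :=
  Q.comp ((formOp o).comp Q)

/-- Unfolding of `planeOp`. [folklore] -/
theorem planeOp_apply (Q : V →L[ℝ] V) (o : V [⋀^Fin 2]→L[ℝ] ℝ) (v : V) :
    planeOp Q o v = Q (formOp o (Q v)) := rfl

/-- `(Q, o) ↦ Ω` is `C^∞`. [folklore] -/
theorem contDiff_planeOp :
    ContDiff ℝ ∞ (fun p : (V →L[ℝ] V) × (V [⋀^Fin 2]→L[ℝ] ℝ) ↦ planeOp p.1 p.2) := by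
  unfold planeOp
  exact contDiff_fst.clm_comp ((contDiff_formOp.comp contDiff_snd).clm_comp contDiff_fst)

/-- **Half the Hilbert–Schmidt norm of `Ω`**, `a² = ½ Σᵢ ‖Ω eᵢ‖²` on the standard orthonormal
basis: the square of the scalar `a` with `Ω² = -a² Q` (`planeOp_comp_planeOp`). [folklore] -/
def planeRotSq (Q : V →L[ℝ] V) (o : V [⋀^Fin 2]→L[ℝ] ℝ) : ℝ :=
  (1 / 2) * ∑ i, ‖planeOp Q o (stdOrthonormalBasis ℝ V i)‖ ^ 2

/-- `(Q, o) ↦ a²` is `C^∞`. [folklore] -/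
theorem contDiff_planeRotSq :
    ContDiff ℝ ∞ (fun p : (V →L[ℝ] V) × (V [⋀^Fin 2]→L[ℝ] ℝ) ↦ planeRotSq p.1 p.2) := by
  unfold planeRotSq
  refine contDiff_const.mul (ContDiff.sum fun i _ ↦ ?_)
  exact (contDiff_planeOp.clm_apply contDiff_const).norm_sq ℝ

/-- **The rotation by a right angle** in the range of `Q`, generated by `o`: `J = a⁻¹ Ω`
(McDuff–Salamon's `(-A²)^{-1/2} A` for a plane). [cite: McDuffSalamon2017, Prop. 2.5.6 (2.5.13)] -/
def planeRot (Q : V →L[ℝ] V) (o : V [⋀^Fin 2]→L[ℝ] ℝ) : V →L[ℝ] V :=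
  (Real.sqrt (planeRotSq Q o))⁻¹ • planeOp Q o

/-- Unfolding of `planeRot`. [folklore] -/
theorem planeRot_def_apply (Q : V →L[ℝ] V) (o : V [⋀^Fin 2]→L[ℝ] ℝ) (v : V) :
    planeRot Q o v = (Real.sqrt (planeRotSq Q o))⁻¹ • planeOp Q o v := rfl

/-- **`(Q, o) ↦ J` is `C^∞` wherever `a² > 0`.** [cite: McDuffSalamon2017, Prop. 2.5.6] -/
theorem contDiffAt_planeRot {p : (V →L[ℝ] V) × (V [⋀^Fin 2]→L[ℝ] ℝ)}
    (hp : 0 < planeRotSq p.1 p.2) :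
    ContDiffAt ℝ ∞ (fun p : (V →L[ℝ] V) × (V [⋀^Fin 2]→L[ℝ] ℝ) ↦ planeRot p.1 p.2) p := by
  have h1 : ContDiffAt ℝ ∞ (fun p : (V →L[ℝ] V) × (V [⋀^Fin 2]→L[ℝ] ℝ) ↦
      (Real.sqrt (planeRotSq p.1 p.2))⁻¹) p :=
    (contDiff_planeRotSq.contDiffAt.sqrt hp.ne').inv (Real.sqrt_pos.2 hp).ne'
  exact h1.smul (contDiff_planeOp (V := V)).contDiffAt

/-! ### The structure of `Ω` and `J` on a `2`-plane -/

section Plane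

variable (W : Submodule ℝ V)

/-- `⟪Ω v, w⟫ = o(Q v, Q w)` for the orthogonal projection `Q` onto `W`. [folklore] -/
theorem inner_planeOp_left (o : V [⋀^Fin 2]→L[ℝ] ℝ) (v w : V) :
    ⟪planeOp W.starProjection o v, w⟫ = o ![W.starProjection v, W.starProjection w] := by
  rw [planeOp_apply, Submodule.inner_starProjection_left_eq_right, inner_formOp_left]

/-- `Ω` is skew. [folklore] -/
theorem inner_planeOp_right (o : V [⋀^Fin 2]→L[ℝ] ℝ) (v w : V) :
    ⟪v, planeOp W.starProjection o w⟫ = -o ![W.starProjection v, W.starProjection w] := by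
  rw [real_inner_comm, inner_planeOp_left, twoForm_swap']

/-- `Ω` takes values in `W`. [folklore] -/
theorem planeOp_apply_mem (o : V [⋀^Fin 2]→L[ℝ] ℝ) (v : V) : planeOp W.starProjection o v ∈ W :=
  Submodule.starProjection_apply_mem W _

/-- `Q Ω = Ω`. [folklore] -/
theorem starProjection_planeOp_apply (o : V [⋀^Fin 2]→L[ℝ] ℝ) (v : V) :
    W.starProjection (planeOp W.starProjection o v) = planeOp W.starProjection o v :=
  Submodule.starProjection_eq_self_iff.2 (planeOp_apply_mem W o v)

/-- `Ω Q = Ω`. [folklore] -/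
theorem planeOp_starProjection_apply (o : V [⋀^Fin 2]→L[ℝ] ℝ) (v : V) :
    planeOp W.starProjection o (W.starProjection v) = planeOp W.starProjection o v := by
  rw [planeOp_apply, planeOp_apply]
  congr 2
  exact Submodule.starProjection_eq_self_iff.2 (Submodule.starProjection_apply_mem W v)

variable {W}

/-- An orthonormal basis of the `2`-plane `W`, indexed by `Fin 2`. [folklore] -/
def planeBasis (hW : finrank ℝ W = 2) : OrthonormalBasis (Fin 2) ℝ W :=
  (stdOrthonormalBasis ℝ W).reindex (finCongr hW)

/-- Inner products of the plane basis. [folklore] -/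
theorem inner_planeBasis (hW : finrank ℝ W = 2) (i j : Fin 2) :
    ⟪((planeBasis hW i : W) : V), ((planeBasis hW j : W) : V)⟫ = if i = j then 1 else 0 := by
  rw [← Submodule.coe_inner]
  exact orthonormal_iff_ite.1 (planeBasis hW).orthonormal i j

/-- The plane basis vectors have unit norm. [folklore] -/
theorem norm_planeBasis (hW : finrank ℝ W = 2) (i : Fin 2) : ‖((planeBasis hW i : W) : V)‖ = 1 := by
  rw [Submodule.norm_coe]
  exact (planeBasis hW).orthonormal.1 i

/-- The projection fixes the plane basis. [folklore] -/
theorem starProjection_planeBasis (hW : finrank ℝ W = 2) (i : Fin 2) :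
    W.starProjection ((planeBasis hW i : W) : V) = ((planeBasis hW i : W) : V) :=
  Submodule.starProjection_eq_self_iff.2 (planeBasis hW i).2

/-- Expansion of an element of `W` on the plane basis. [folklore] -/
theorem sum_inner_planeBasis_smul (hW : finrank ℝ W = 2) {w : V} (hw : w ∈ W) :
    ⟪w, ((planeBasis hW 0 : W) : V)⟫ • ((planeBasis hW 0 : W) : V) +
      ⟪w, ((planeBasis hW 1 : W) : V)⟫ • ((planeBasis hW 1 : W) : V) = w := by
  have h := (planeBasis hW).sum_repr' ⟨w, hw⟩
  rw [Fin.sum_univ_two] at h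
  have h' := congrArg Subtype.val h
  simp only [Submodule.coe_add, Submodule.coe_smul, Submodule.coe_inner] at h'
  rw [real_inner_comm w, real_inner_comm w] at h'
  exact h'

/-- `⟪Q v, uᵢ⟫ = ⟪v, uᵢ⟫` for the plane basis. [folklore] -/
theorem inner_starProjection_planeBasis (hW : finrank ℝ W = 2) (v : V) (i : Fin 2) :
    ⟪W.starProjection v, ((planeBasis hW i : W) : V)⟫ = ⟪v, ((planeBasis hW i : W) : V)⟫ := by
  rw [Submodule.inner_starProjection_left_eq_right, starProjection_planeBasis]

/-- **The orthogonal projection onto `W` on the plane basis**: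
`Q v = ⟪v, u₀⟫ u₀ + ⟪v, u₁⟫ u₁`. [folklore] -/
theorem starProjection_eq_planeBasis (hW : finrank ℝ W = 2) (v : V) :
    W.starProjection v = ⟪v, ((planeBasis hW 0 : W) : V)⟫ • ((planeBasis hW 0 : W) : V) +
      ⟪v, ((planeBasis hW 1 : W) : V)⟫ • ((planeBasis hW 1 : W) : V) := by
  calc W.starProjection v
      = ⟪W.starProjection v, ((planeBasis hW 0 : W) : V)⟫ • ((planeBasis hW 0 : W) : V) +
          ⟪W.starProjection v, ((planeBasis hW 1 : W) : V)⟫ • ((planeBasis hW 1 : W) : V) :=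
        (sum_inner_planeBasis_smul hW (Submodule.starProjection_apply_mem W v)).symm
    _ = _ := by rw [inner_starProjection_planeBasis, inner_starProjection_planeBasis]

/-- `‖Q v‖² = ⟪v, u₀⟫² + ⟪v, u₁⟫²`. [folklore] -/
theorem norm_starProjection_sq (hW : finrank ℝ W = 2) (v : V) :
    ‖W.starProjection v‖ ^ 2 =
      ⟪v, ((planeBasis hW 0 : W) : V)⟫ ^ 2 + ⟪v, ((planeBasis hW 1 : W) : V)⟫ ^ 2 := by
  have h00 := inner_planeBasis hW 0 0
  have h01 := inner_planeBasis hW 0 1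
  have h10 := inner_planeBasis hW 1 0
  have h11 := inner_planeBasis hW 1 1
  simp only [if_true, if_neg (show (0 : Fin 2) ≠ 1 by decide),
    if_neg (show (1 : Fin 2) ≠ 0 by decide)] at h00 h01 h10 h11
  rw [← real_inner_self_eq_norm_sq, starProjection_eq_planeBasis hW v]
  simp only [inner_add_left, inner_add_right, real_inner_smul_left, real_inner_smul_right,
    h00, h01, h10, h11]
  ring

/-- The coefficient `α = o(u₀, u₁)` of `o` on the plane basis. [folklore] -/
def planeCoeff (hW : finrank ℝ W = 2) (o : V [⋀^Fin 2]→L[ℝ] ℝ) : ℝ :=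
  o ![((planeBasis hW 0 : W) : V), ((planeBasis hW 1 : W) : V)]

omit [FiniteDimensional ℝ V] in
/-- Bilinearity of `o` in the first slot on a two-term combination. [folklore] -/
theorem twoForm_add_smul_left (o : V [⋀^Fin 2]→L[ℝ] ℝ) (a c : ℝ) (x y w : V) :
    o ![a • x + c • y, w] = a * o ![x, w] + c * o ![y, w] := by
  rw [← alt2Flat_apply, map_add, map_smul, map_smul]
  show a • alt2Flat o x w + c • alt2Flat o y w = _
  rw [alt2Flat_apply, alt2Flat_apply]
  rfl

/-- **`Ω` on the plane basis**: `Ω v = α (⟪v, u₀⟫ u₁ - ⟪v, u₁⟫ u₀)`. [folklore] -/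
theorem planeOp_eq_planeBasis (hW : finrank ℝ W = 2) (o : V [⋀^Fin 2]→L[ℝ] ℝ) (v : V) :
    planeOp W.starProjection o v = planeCoeff hW o •
      (⟪v, ((planeBasis hW 0 : W) : V)⟫ • ((planeBasis hW 1 : W) : V) -
        ⟪v, ((planeBasis hW 1 : W) : V)⟫ • ((planeBasis hW 0 : W) : V)) := by
  have e0 : ⟪planeOp W.starProjection o v, ((planeBasis hW 0 : W) : V)⟫ =
      -(⟪v, ((planeBasis hW 1 : W) : V)⟫ * planeCoeff hW o) := by
    rw [inner_planeOp_left, starProjection_planeBasis, starProjection_eq_planeBasis hW v,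
      twoForm_add_smul_left, twoForm_self, twoForm_swap' o _ ((planeBasis hW 0 : W) : V),
      planeCoeff]
    ring
  have e1 : ⟪planeOp W.starProjection o v, ((planeBasis hW 1 : W) : V)⟫ =
      ⟪v, ((planeBasis hW 0 : W) : V)⟫ * planeCoeff hW o := by
    rw [inner_planeOp_left, starProjection_planeBasis, starProjection_eq_planeBasis hW v,
      twoForm_add_smul_left, twoForm_self, planeCoeff]
    ring
  calc planeOp W.starProjection o v
      = ⟪planeOp W.starProjection o v, ((planeBasis hW 0 : W) : V)⟫ • ((planeBasis hW 0 : W) : V) +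
          ⟪planeOp W.starProjection o v, ((planeBasis hW 1 : W) : V)⟫ •
            ((planeBasis hW 1 : W) : V) :=
        (sum_inner_planeBasis_smul hW (planeOp_apply_mem W o v)).symm
    _ = _ := by
        rw [e0, e1]
        module

/-- **`o` on the plane in terms of `α`**:
`o(Q v, Q w) = α (⟪v, u₀⟫ ⟪w, u₁⟫ - ⟪v, u₁⟫ ⟪w, u₀⟫)`. [folklore] -/
theorem twoForm_starProjection_eq (hW : finrank ℝ W = 2) (o : V [⋀^Fin 2]→L[ℝ] ℝ) (v w : V) :
    o ![W.starProjection v, W.starProjection w] = planeCoeff hW o *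
      (⟪v, ((planeBasis hW 0 : W) : V)⟫ * ⟪w, ((planeBasis hW 1 : W) : V)⟫ -
        ⟪v, ((planeBasis hW 1 : W) : V)⟫ * ⟪w, ((planeBasis hW 0 : W) : V)⟫) := by
  rw [← inner_planeOp_left, planeOp_eq_planeBasis hW]
  simp only [real_inner_smul_left, inner_sub_left]
  rw [real_inner_comm _ w, real_inner_comm _ w]

/-- **`Ω² = -α² Q`.** [folklore] -/
theorem planeOp_planeOp_apply (hW : finrank ℝ W = 2) (o : V [⋀^Fin 2]→L[ℝ] ℝ) (v : V) :
    planeOp W.starProjection o (planeOp W.starProjection o v) =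
      -(planeCoeff hW o ^ 2 • W.starProjection v) := by
  have h00 := inner_planeBasis hW 0 0
  have h01 := inner_planeBasis hW 0 1
  have h10 := inner_planeBasis hW 1 0
  have h11 := inner_planeBasis hW 1 1
  simp only [if_true, if_neg (show (0 : Fin 2) ≠ 1 by decide),
    if_neg (show (1 : Fin 2) ≠ 0 by decide)] at h00 h01 h10 h11
  rw [planeOp_eq_planeBasis hW o (planeOp W.starProjection o v), planeOp_eq_planeBasis hW o v,
    starProjection_eq_planeBasis hW v]
  simp only [real_inner_smul_left, inner_sub_left, h00, h01, h10, h11, mul_one, mul_zero,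
    sub_zero, zero_sub, pow_two]
  module

/-- `Ω` is skew: `⟪Ω v, w⟫ = -⟪v, Ω w⟫`. [folklore] -/
theorem inner_planeOp_left_eq_neg (o : V [⋀^Fin 2]→L[ℝ] ℝ) (v w : V) :
    ⟪planeOp W.starProjection o v, w⟫ = -⟪v, planeOp W.starProjection o w⟫ := by
  rw [inner_planeOp_left, inner_planeOp_right, neg_neg]

/-- `⟪v, Q v⟫ = ‖Q v‖²`. [folklore] -/
theorem inner_starProjection_self (v : V) :
    ⟪v, W.starProjection v⟫ = ‖W.starProjection v‖ ^ 2 := by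
  have hid : W.starProjection (W.starProjection v) = W.starProjection v :=
    Submodule.starProjection_eq_self_iff.2 (Submodule.starProjection_apply_mem W v)
  rw [← real_inner_self_eq_norm_sq, Submodule.inner_starProjection_left_eq_right, hid]

/-- **`⟪Ω v, Ω w⟫ = α² ⟪Q v, Q w⟫`.** [folklore] -/
theorem inner_planeOp_planeOp (hW : finrank ℝ W = 2) (o : V [⋀^Fin 2]→L[ℝ] ℝ) (v w : V) :
    ⟪planeOp W.starProjection o v, planeOp W.starProjection o w⟫ =
      planeCoeff hW o ^ 2 * ⟪W.starProjection v, W.starProjection w⟫ := by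
  have hid : W.starProjection (W.starProjection w) = W.starProjection w :=
    Submodule.starProjection_eq_self_iff.2 (Submodule.starProjection_apply_mem W w)
  rw [inner_planeOp_left_eq_neg, planeOp_planeOp_apply hW, inner_neg_right, neg_neg,
    real_inner_smul_right, Submodule.inner_starProjection_left_eq_right, hid]

/-- The squared norm of `Ω v` is `α² ‖Q v‖²`. [folklore] -/
theorem norm_planeOp_sq (hW : finrank ℝ W = 2) (o : V [⋀^Fin 2]→L[ℝ] ℝ) (v : V) :
    ‖planeOp W.starProjection o v‖ ^ 2 = planeCoeff hW o ^ 2 * ‖W.starProjection v‖ ^ 2 := by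
  rw [← real_inner_self_eq_norm_sq, ← real_inner_self_eq_norm_sq, inner_planeOp_planeOp hW]

/-- **`a² = α²`**: half the Hilbert–Schmidt norm of `Ω` is the square of the coefficient of `o`
on an orthonormal basis of the plane (Parseval: `Σᵢ ‖Q eᵢ‖² = dim W = 2`). [folklore] -/
theorem planeRotSq_eq (hW : finrank ℝ W = 2) (o : V [⋀^Fin 2]→L[ℝ] ℝ) :
    planeRotSq W.starProjection o = planeCoeff hW o ^ 2 := by
  unfold planeRotSq
  simp_rw [norm_planeOp_sq hW, norm_starProjection_sq hW, ← Finset.mul_sum, Finset.sum_add_distrib]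
  have hP : ∀ x : V, ∑ i, ⟪stdOrthonormalBasis ℝ V i, x⟫ ^ 2 = ‖x‖ ^ 2 := fun x ↦ by
    rw [← real_inner_self_eq_norm_sq, ← (stdOrthonormalBasis ℝ V).sum_inner_mul_inner x x]
    refine Finset.sum_congr rfl fun i _ ↦ ?_
    rw [pow_two, real_inner_comm x]
  rw [hP, hP, norm_planeBasis, norm_planeBasis]
  ring

/-- Non-vanishing of `o` on the plane forces `α ≠ 0`. [folklore] -/
theorem planeCoeff_ne_zero (hW : finrank ℝ W = 2) (o : V [⋀^Fin 2]→L[ℝ] ℝ)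
    (ho : ∃ v w, o ![W.starProjection v, W.starProjection w] ≠ 0) : planeCoeff hW o ≠ 0 := by
  obtain ⟨v, w, h⟩ := ho
  intro h0
  rw [twoForm_starProjection_eq hW, h0, zero_mul] at h
  exact h rfl

/-- **`a² > 0` iff `o` does not vanish on the plane.** [folklore] -/
theorem planeRotSq_pos_iff (hW : finrank ℝ W = 2) (o : V [⋀^Fin 2]→L[ℝ] ℝ) :
    0 < planeRotSq W.starProjection o ↔
      ∃ v w, o ![W.starProjection v, W.starProjection w] ≠ 0 := by
  rw [planeRotSq_eq hW]
  constructor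
  · intro h
    have hα : planeCoeff hW o ≠ 0 := by
      intro h0; rw [h0] at h; simp at h
    refine ⟨((planeBasis hW 0 : W) : V), ((planeBasis hW 1 : W) : V), ?_⟩
    rwa [starProjection_planeBasis, starProjection_planeBasis]
  · intro h
    exact pow_pos (abs_pos.2 (planeCoeff_ne_zero hW o h)) 2 |>.trans_eq (sq_abs _)

/-- `√(a²) = |α|`. [folklore] -/
theorem sqrt_planeRotSq (hW : finrank ℝ W = 2) (o : V [⋀^Fin 2]→L[ℝ] ℝ) :
    Real.sqrt (planeRotSq W.starProjection o) = |planeCoeff hW o| := by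
  rw [planeRotSq_eq hW, Real.sqrt_sq_eq_abs]

/-- Unfolding of `planeRot` on the plane: `J v = |α|⁻¹ Ω v`. [folklore] -/
theorem planeRot_apply (hW : finrank ℝ W = 2) (o : V [⋀^Fin 2]→L[ℝ] ℝ) (v : V) :
    planeRot W.starProjection o v = |planeCoeff hW o|⁻¹ • planeOp W.starProjection o v := by
  rw [planeRot_def_apply, sqrt_planeRotSq hW]

/-- **`J² = -Q`.** [cite: McDuffSalamon2017, Prop. 2.5.6 (2.5.14)] -/
theorem planeRot_planeRot_apply (hW : finrank ℝ W = 2) {o : V [⋀^Fin 2]→L[ℝ] ℝ} (ho : ∃ v w, o ![W.starProjection v, W.starProjection w] ≠ 0)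
    (v : V) :
    planeRot W.starProjection o (planeRot W.starProjection o v) = -W.starProjection v := by
  have hα := planeCoeff_ne_zero hW o ho
  have habs : |planeCoeff hW o| ≠ 0 := abs_ne_zero.2 hα
  rw [planeRot_apply hW, planeRot_apply hW, map_smul, planeOp_planeOp_apply hW, smul_smul,
    smul_neg, smul_smul]
  congr 1
  rw [show |planeCoeff hW o|⁻¹ * |planeCoeff hW o|⁻¹ * planeCoeff hW o ^ 2 = 1 by
    rw [← sq_abs (planeCoeff hW o)]; field_simp, one_smul]

/-- `J` takes values in `W`. [folklore] -/
theorem planeRot_apply_mem {o : V [⋀^Fin 2]→L[ℝ] ℝ} (v : V) : planeRot W.starProjection o v ∈ W := by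
  rw [planeRot_def_apply]
  exact W.smul_mem _ (planeOp_apply_mem W o v)

/-- **`Q J = J`.** [folklore] -/
theorem starProjection_planeRot_apply {o : V [⋀^Fin 2]→L[ℝ] ℝ} (v : V) :
    W.starProjection (planeRot W.starProjection o v) = planeRot W.starProjection o v :=
  Submodule.starProjection_eq_self_iff.2 (planeRot_apply_mem v)

/-- **`J Q = J`.** [folklore] -/
theorem planeRot_starProjection_apply {o : V [⋀^Fin 2]→L[ℝ] ℝ} (v : V) :
    planeRot W.starProjection o (W.starProjection v) = planeRot W.starProjection o v := by
  rw [planeRot_def_apply, planeRot_def_apply, planeOp_starProjection_apply]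

/-- **`J` is skew**: `⟪J v, w⟫ = -⟪v, J w⟫`. [folklore] -/
theorem inner_planeRot_left_eq_neg {o : V [⋀^Fin 2]→L[ℝ] ℝ} (v w : V) :
    ⟪planeRot W.starProjection o v, w⟫ = -⟪v, planeRot W.starProjection o w⟫ := by
  rw [planeRot_def_apply, planeRot_def_apply, real_inner_smul_left, real_inner_smul_right,
    inner_planeOp_left_eq_neg, mul_neg]

/-- `⟪J v, v⟫ = 0`. [folklore] -/
theorem inner_planeRot_self {o : V [⋀^Fin 2]→L[ℝ] ℝ} (v : V) : ⟪planeRot W.starProjection o v, v⟫ = 0 := by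
  have h := inner_planeRot_left_eq_neg (W := W) (o := o) v v
  rw [real_inner_comm v] at h
  have h' : ⟪planeRot W.starProjection o v, v⟫ = ⟪v, planeRot W.starProjection o v⟫ :=
    real_inner_comm _ _
  linarith

/-- **`J` is an isometry of the plane**: `⟪J v, J w⟫ = ⟪Q v, Q w⟫`.
[cite: McDuffSalamon2017, Prop. 2.5.6 (2.5.14)] -/
theorem inner_planeRot_planeRot (hW : finrank ℝ W = 2) {o : V [⋀^Fin 2]→L[ℝ] ℝ} (ho : ∃ v w, o ![W.starProjection v, W.starProjection w] ≠ 0)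
    (v w : V) :
    ⟪planeRot W.starProjection o v, planeRot W.starProjection o w⟫ =
      ⟪W.starProjection v, W.starProjection w⟫ := by
  have hα := planeCoeff_ne_zero hW o ho
  have habs : |planeCoeff hW o| ≠ 0 := abs_ne_zero.2 hα
  rw [planeRot_apply hW, planeRot_apply hW, real_inner_smul_left, real_inner_smul_right,
    inner_planeOp_planeOp hW, ← sq_abs (planeCoeff hW o)]
  field_simp

/-- `‖J v‖ = ‖Q v‖`. [folklore] -/
theorem norm_planeRot (hW : finrank ℝ W = 2) {o : V [⋀^Fin 2]→L[ℝ] ℝ} (ho : ∃ v w, o ![W.starProjection v, W.starProjection w] ≠ 0) (v : V) :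
    ‖planeRot W.starProjection o v‖ = ‖W.starProjection v‖ := by
  have h := inner_planeRot_planeRot hW ho v v
  rw [real_inner_self_eq_norm_sq, real_inner_self_eq_norm_sq] at h
  exact (sq_eq_sq₀ (norm_nonneg _) (norm_nonneg _)).1 h

/-- **`o(Q v, J v) = |α| ‖Q v‖²`**: the form is positive on the pairs `(v, J v)`.
[cite: McDuffSalamon2017, Prop. 2.5.6 (2.5.14)] -/
theorem twoForm_planeRot_eq (hW : finrank ℝ W = 2) {o : V [⋀^Fin 2]→L[ℝ] ℝ} (v : V) :
    o ![W.starProjection v, planeRot W.starProjection o v] =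
      |planeCoeff hW o| * ‖W.starProjection v‖ ^ 2 := by
  rw [← starProjection_planeRot_apply (o := o) v, ← inner_planeOp_left, planeRot_apply hW,
    real_inner_smul_right, inner_planeOp_planeOp hW, real_inner_self_eq_norm_sq,
    ← sq_abs (planeCoeff hW o)]
  by_cases h : |planeCoeff hW o| = 0
  · rw [h]; simp
  · rw [← mul_assoc, pow_two, ← mul_assoc, inv_mul_cancel₀ h, one_mul]

/-- **Positivity: `o(Q v, J v) > 0` whenever `Q v ≠ 0`** — `J` rotates in the positive sense
for the orientation of the plane defined by `o`. [cite: McDuffSalamon2017, Prop. 2.5.6 (2.5.14)] -/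
theorem twoForm_planeRot_pos (hW : finrank ℝ W = 2) {o : V [⋀^Fin 2]→L[ℝ] ℝ} (ho : ∃ v w, o ![W.starProjection v, W.starProjection w] ≠ 0)
    {v : V} (hv : W.starProjection v ≠ 0) :
    0 < o ![W.starProjection v, planeRot W.starProjection o v] := by
  rw [twoForm_planeRot_eq hW]
  exact mul_pos (abs_pos.2 (planeCoeff_ne_zero hW o ho)) (pow_pos (norm_pos_iff.2 hv) 2)

/-- `J v = 0` iff `Q v = 0` (when `o` does not vanish on the plane). [folklore] -/
theorem planeRot_apply_eq_zero_iff (hW : finrank ℝ W = 2) {o : V [⋀^Fin 2]→L[ℝ] ℝ} (ho : ∃ v w, o ![W.starProjection v, W.starProjection w] ≠ 0)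
    (v : V) : planeRot W.starProjection o v = 0 ↔ W.starProjection v = 0 := by
  rw [← norm_eq_zero, norm_planeRot hW ho, norm_eq_zero]

/-- **`J` on the plane basis**: `J u₀ = ε u₁`, `J u₁ = -ε u₀` with `ε = α/|α| = ±1`. [folklore] -/
theorem planeRot_planeBasis_zero (hW : finrank ℝ W = 2) {o : V [⋀^Fin 2]→L[ℝ] ℝ} :
    planeRot W.starProjection o ((planeBasis hW 0 : W) : V) =
      (|planeCoeff hW o|⁻¹ * planeCoeff hW o) • ((planeBasis hW 1 : W) : V) := by
  have h00 := inner_planeBasis hW 0 0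
  have h01 := inner_planeBasis hW 0 1
  simp only [if_true, if_neg (show (0 : Fin 2) ≠ 1 by decide)] at h00 h01
  rw [planeRot_apply hW, planeOp_eq_planeBasis hW, h00, h01, one_smul, zero_smul, sub_zero,
    smul_smul]

/-- `J u₁ = -ε u₀`. [folklore] -/
theorem planeRot_planeBasis_one (hW : finrank ℝ W = 2) {o : V [⋀^Fin 2]→L[ℝ] ℝ} :
    planeRot W.starProjection o ((planeBasis hW 1 : W) : V) =
      -((|planeCoeff hW o|⁻¹ * planeCoeff hW o) • ((planeBasis hW 0 : W) : V)) := by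
  have h10 := inner_planeBasis hW 1 0
  have h11 := inner_planeBasis hW 1 1
  simp only [if_true, if_neg (show (1 : Fin 2) ≠ 0 by decide)] at h10 h11
  rw [planeRot_apply hW, planeOp_eq_planeBasis hW, h10, h11, one_smul, zero_smul, zero_sub,
    smul_neg, smul_neg, smul_smul]

/-! ### The rotations `R_a = (1 - Q) + (Re a) Q + (Im a) J` -/

/-- **The rotation of the plane by the complex number `a`** (identity on `Wᗮ`):
`R_a = (1 - Q) + (Re a) Q + (Im a) J`; for `|a| = 1` this is the rotation by the angle of `a`
in the positive sense defined by `o`, i.e. the `U(1)`-action on the normal planes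
(McLean 2012, Lemma 5.14: structure group `U(1)`). [cite: Mclean2012, Lemma 5.14] -/
def planeTurn (Q : V →L[ℝ] V) (o : V [⋀^Fin 2]→L[ℝ] ℝ) (a : ℂ) : V →L[ℝ] V :=
  (1 - Q) + a.re • Q + a.im • planeRot Q o

/-- Unfolding of `planeTurn`. [folklore] -/
theorem planeTurn_apply (Q : V →L[ℝ] V) (o : V [⋀^Fin 2]→L[ℝ] ℝ) (a : ℂ) (v : V) :
    planeTurn Q o a v = (v - Q v) + a.re • Q v + a.im • planeRot Q o v := rfl

/-- `R_1 = id`. [folklore] -/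
theorem planeTurn_one_apply (Q : V →L[ℝ] V) (o : V [⋀^Fin 2]→L[ℝ] ℝ) (v : V) :
    planeTurn Q o 1 v = v := by
  rw [planeTurn_apply, Complex.one_re, Complex.one_im, one_smul, zero_smul, add_zero,
    sub_add_cancel]

/-- `R_a` on the plane: `R_a v = (Re a) v + (Im a) J v` for `v ∈ W`. [folklore] -/
theorem planeTurn_apply_of_mem {o : V [⋀^Fin 2]→L[ℝ] ℝ} (a : ℂ) {v : V} (hv : v ∈ W) :
    planeTurn W.starProjection o a v = a.re • v + a.im • planeRot W.starProjection o v := by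
  rw [planeTurn_apply, Submodule.starProjection_eq_self_iff.2 hv, sub_self, zero_add]

/-- `R_a` is the identity on `Wᗮ`-components: `R_a v - Q (R_a v) = v - Q v`. [folklore] -/
theorem starProjection_planeTurn_apply {o : V [⋀^Fin 2]→L[ℝ] ℝ} (a : ℂ) (v : V) :
    W.starProjection (planeTurn W.starProjection o a v) =
      a.re • W.starProjection v + a.im • planeRot W.starProjection o v := by
  have hid : W.starProjection (W.starProjection v) = W.starProjection v :=
    Submodule.starProjection_eq_self_iff.2 (Submodule.starProjection_apply_mem W v)
  rw [planeTurn_apply, map_add, map_add, map_sub, map_smul, map_smul, hid, sub_self, zero_add,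
    starProjection_planeRot_apply]

/-- `R_a v - Q (R_a v) = v - Q v`. [folklore] -/
theorem planeTurn_sub_starProjection {o : V [⋀^Fin 2]→L[ℝ] ℝ} (a : ℂ) (v : V) :
    planeTurn W.starProjection o a v - W.starProjection (planeTurn W.starProjection o a v) =
      v - W.starProjection v := by
  rw [starProjection_planeTurn_apply, planeTurn_apply]
  abel

/-- `R_a ∘ Q = Q-part of R_a`: `R_a (Q v) = (Re a) Q v + (Im a) J v`. [folklore] -/
theorem planeTurn_starProjection_apply {o : V [⋀^Fin 2]→L[ℝ] ℝ} (a : ℂ) (v : V) :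
    planeTurn W.starProjection o a (W.starProjection v) =
      a.re • W.starProjection v + a.im • planeRot W.starProjection o v := by
  rw [planeTurn_apply_of_mem a (Submodule.starProjection_apply_mem W v),
    planeRot_starProjection_apply]

/-- **The group law `R_a (R_b v) = R_{ab} v`** (for all complex `a, b`).
[cite: Mclean2012, Lemma 5.14] -/
theorem planeTurn_planeTurn_apply (hW : finrank ℝ W = 2) {o : V [⋀^Fin 2]→L[ℝ] ℝ}
    (ho : ∃ v w, o ![W.starProjection v, W.starProjection w] ≠ 0) (a b : ℂ) (v : V) :
    planeTurn W.starProjection o a (planeTurn W.starProjection o b v) =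
      planeTurn W.starProjection o (a * b) v := by
  -- split `R_b v` into its normal part `v - Q v` and its plane part
  have hsplit : planeTurn W.starProjection o b v =
      (v - W.starProjection v) + (b.re • W.starProjection v + b.im • planeRot W.starProjection o v) := by
    rw [planeTurn_apply, add_assoc]
  have hn : planeTurn W.starProjection o a (v - W.starProjection v) = v - W.starProjection v := by
    have hid : W.starProjection (W.starProjection v) = W.starProjection v :=
      Submodule.starProjection_eq_self_iff.2 (Submodule.starProjection_apply_mem W v)
    rw [planeTurn_apply, map_sub, hid, sub_self, smul_zero, add_zero, sub_zero, map_sub,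
      planeRot_starProjection_apply, sub_self, smul_zero, add_zero]
  have hmem : b.re • W.starProjection v + b.im • planeRot W.starProjection o v ∈ W :=
    W.add_mem (W.smul_mem _ (Submodule.starProjection_apply_mem W v))
      (W.smul_mem _ (planeRot_apply_mem v))
  rw [hsplit, map_add, hn, planeTurn_apply_of_mem a hmem, map_add, map_smul, map_smul,
    planeRot_starProjection_apply, planeRot_planeRot_apply hW ho, planeTurn_apply, Complex.mul_re,
    Complex.mul_im, add_assoc]
  congr 1
  module

/-- `‖R_a v‖² = ‖v - Q v‖² + |a|² ‖Q v‖²`. [folklore] -/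
theorem norm_planeTurn_sq (hW : finrank ℝ W = 2) {o : V [⋀^Fin 2]→L[ℝ] ℝ}
    (ho : ∃ v w, o ![W.starProjection v, W.starProjection w] ≠ 0) (a : ℂ) (v : V) :
    ‖planeTurn W.starProjection o a v‖ ^ 2 =
      ‖v - W.starProjection v‖ ^ 2 + Complex.normSq a * ‖W.starProjection v‖ ^ 2 := by
  have hmem : a.re • W.starProjection v + a.im • planeRot W.starProjection o v ∈ W :=
    W.add_mem (W.smul_mem _ (Submodule.starProjection_apply_mem W v))
      (W.smul_mem _ (planeRot_apply_mem v))
  have hperp : ⟪v - W.starProjection v,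
      a.re • W.starProjection v + a.im • planeRot W.starProjection o v⟫ = 0 :=
    Submodule.inner_left_of_mem_orthogonal hmem (Submodule.sub_starProjection_mem_orthogonal v)
  have hJQ : ⟪a.re • W.starProjection v, a.im • planeRot W.starProjection o v⟫ = 0 := by
    rw [real_inner_smul_left, real_inner_smul_right, real_inner_comm,
      ← planeRot_starProjection_apply, inner_planeRot_self, mul_zero, mul_zero]
  have h1 := norm_add_sq_eq_norm_sq_add_norm_sq_of_inner_eq_zero _ _ hperp
  have h2 := norm_add_sq_eq_norm_sq_add_norm_sq_of_inner_eq_zero _ _ hJQ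
  rw [planeTurn_apply, add_assoc, pow_two, h1, h2, norm_smul, norm_smul, Real.norm_eq_abs,
    Real.norm_eq_abs, norm_planeRot hW ho, Complex.normSq_apply,
    show |a.re| * ‖W.starProjection v‖ * (|a.re| * ‖W.starProjection v‖) =
      a.re * a.re * (‖W.starProjection v‖ * ‖W.starProjection v‖) by
        rw [← abs_mul_abs_self a.re]; ring,
    show |a.im| * ‖W.starProjection v‖ * (|a.im| * ‖W.starProjection v‖) =
      a.im * a.im * (‖W.starProjection v‖ * ‖W.starProjection v‖) by
        rw [← abs_mul_abs_self a.im]; ring]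
  ring

/-- **Unit rotations are isometries**: `‖R_a v‖ = ‖v‖` for `|a| = 1`. [folklore] -/
theorem norm_planeTurn_of_normSq_eq_one (hW : finrank ℝ W = 2) {o : V [⋀^Fin 2]→L[ℝ] ℝ}
    (ho : ∃ v w, o ![W.starProjection v, W.starProjection w] ≠ 0) {a : ℂ}
    (ha : Complex.normSq a = 1) (v : V) :
    ‖planeTurn W.starProjection o a v‖ = ‖v‖ := by
  have h := norm_planeTurn_sq hW ho a v
  rw [ha, one_mul] at h
  have hpy : ‖v - W.starProjection v‖ ^ 2 + ‖W.starProjection v‖ ^ 2 = ‖v‖ ^ 2 := by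
    have hperp : ⟪v - W.starProjection v, W.starProjection v⟫ = 0 :=
      Submodule.inner_left_of_mem_orthogonal (Submodule.starProjection_apply_mem W v)
        (Submodule.sub_starProjection_mem_orthogonal v)
    have := norm_add_sq_eq_norm_sq_add_norm_sq_of_inner_eq_zero _ _ hperp
    rw [sub_add_cancel] at this
    simp only [← pow_two] at this
    linarith
  rw [hpy] at h
  exact (sq_eq_sq₀ (norm_nonneg _) (norm_nonneg _)).1 h

/-- **The `U(1)`-action**: `R_a (R_b v) = R_{ab} v`, `R_1 = id` for `a, b ∈ S¹`. [cite: Mclean2012, Lemma 5.14] -/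
theorem planeTurn_circle_mul (hW : finrank ℝ W = 2) {o : V [⋀^Fin 2]→L[ℝ] ℝ}
    (ho : ∃ v w, o ![W.starProjection v, W.starProjection w] ≠ 0) (a b : Circle) (v : V) :
    planeTurn W.starProjection o ((a * b : Circle) : ℂ) v =
      planeTurn W.starProjection o (a : ℂ) (planeTurn W.starProjection o (b : ℂ) v) := by
  rw [planeTurn_planeTurn_apply hW ho, Circle.coe_mul]

/-- The only unit rotation fixing a non-zero vector of the plane is the identity. [folklore] -/
theorem eq_one_of_planeTurn_apply_eq {o : V [⋀^Fin 2]→L[ℝ] ℝ} {a : Circle} {v : V}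
    (hv : W.starProjection v ≠ 0) (h : planeTurn W.starProjection o (a : ℂ) v = v) : a = 1 := by
  -- read off `Re a = 1` from `⟪Q (R_a v), Q v⟫ = Re a ‖Q v‖²`
  have hQ := congrArg W.starProjection h
  rw [starProjection_planeTurn_apply] at hQ
  have hJQ : ⟪planeRot W.starProjection o v, W.starProjection v⟫ = 0 := by
    rw [← planeRot_starProjection_apply]
    exact inner_planeRot_self _
  have hinner := congrArg (fun w ↦ ⟪w, W.starProjection v⟫) hQ
  simp only [inner_add_left, real_inner_smul_left, hJQ, mul_zero, add_zero,
    real_inner_self_eq_norm_sq] at hinner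
  have hn : ‖W.starProjection v‖ ^ 2 ≠ 0 := pow_ne_zero 2 (norm_ne_zero_iff.2 hv)
  have hre : (a : ℂ).re = 1 := by
    have := mul_right_cancel₀ hn (hinner.trans (one_mul _).symm)
    exact this
  have hsq : Complex.normSq (a : ℂ) = 1 := by
    rw [Complex.normSq_eq_norm_sq, Circle.norm_coe, one_pow]
  have him : (a : ℂ).im = 0 := by
    rw [Complex.normSq_apply, hre] at hsq
    nlinarith
  exact Circle.ext (Complex.ext (by rw [hre]; rfl) (by rw [him]; rfl))

end Plane

end Literature.Geometry.Symplectic
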